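import Summits.CriticalPhenomena.PercolationContinuityZ3.Theorems.PercNonProliferationNonProliferationStubTypeTable
import Summits.CriticalPhenomena.PercolationContinuityZ3.Theorems.PercNonProliferationNonProliferationStubSignedRusso
import Summits.CriticalPhenomena.PercolationContinuityZ3.Theorems.PercNonProliferationNonProliferationStubScreening
import Summits.CriticalPhenomena.PercolationContinuityZ3.Theorems.PercNonProliferationNonProliferationStubAnchor
import Summits.CriticalPhenomena.PercolationContinuityZ3.Theorems.PercNonProliferationNonProliferationStubLedger
import Summits.CriticalPhenomena.PercolationContinuityZ3.Theorems.PercNonProliferationNonProliferationStubLogLedger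
import Summits.CriticalPhenomena.PercolationContinuityZ3.Theorems.NonProliferation.Negative.MZeroSlice
import HarnessLib

/-!
# Crux `PercNonProliferation.NonProliferation` (stmt-CriticalPhenomena-4444), line `birth-merge-ledger` —
# the window reduction and its calibration (lead's file)

With the six provable stubs of the line landed as theorems (`stub_typeTable`, `stub_signedRusso`,
`stub_screening`, `stub_anchor`, `stub_ledger`, `stub_logLedger`), the birth–merge LEDGER
`E_b[N_n] - E_a[N_n] = ∫_a^b births - ∫_a^b merges` (`WindowReduction.ledger`) and the LOG-LEDGER
`E_b[N_n] + ∫_0^b merges ≤ -log(1 - u_n(b))` (`WindowReduction.logLedger`; here `E_t[N_n] =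
Σ_{k<#B(n)} P_t(repEvent d k n)` is the expected number of clusters of the open graph induced on
`B(2n)` meeting `B(n)` and `∂ⁱⁿB(2n)`, `u_n(t) = P_t(annulusCrossing d n)`) hold unconditionally, in
every dimension. This file records the consequences that do not depend on the open stub:

* `sum_real_repEvent_le_neg_log` / `real_compl_annulusCrossing_le_exp`: at every parameter `p` and
  every `n ≥ 1`, `E_p[N_n] ≤ -log P_p(B(n) ↮ ∂ⁱⁿB(2n) in B(2n))`, i.e. the annulus is blocked with
  probability at most `exp(-E_p[N_n])` — an exponential sharpening of the route's BK cap
  `SpanningBKCap` (`E N ≤ (1-u)/u`), usable by the provers of items stmt-4446 / stmt-4458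
  (`SubpolynomialBlocking` then forces `E_{p_c} N_n ≤ s log n` for every `s > 0`).
* `frequently_of_window`: in dimension `d ≥ 1`, a WINDOW BIRTH BUDGET (`∃ C, ∃ᶠ n, ∃ s ≤ p_c` with
  `u_n(s) ≤ 1/2` and `∫_s^{p_c} births ≤ C`) gives `M`, `c = 1/2` with `P_{p_c}(N_n ≤ M) ≥ 1/2`
  frequently (`E_{p_c} N ≤ log 2 + C`, Markov over the antitone family `repEvent`).
* `nonProliferation_of_windowBirths` (registered extra stub of the crux): the `d = 3` instance — the
  crux BY NAME follows from the line's one open stub `stub_windowBirths` alone.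
* `not_windowBirths_of_twoPointBoundedRatio`: calibration against the barrier
  `SpanningClustersAboveSix` — for `d ≥ 7` with Aizenman's (t-c) at `η = 0` the window birth budget
  FAILS (`Negative.nonProliferation_false_of_twoPointBoundedRatio`), so the open stub is exactly where
  `d = 3` must enter.
-/

noncomputable section

namespace Summit.CriticalPhenomena.PercolationContinuityZ3.Theorems.NonProliferation

open MeasureTheory Filter Topology
open Literature.Probability.LatticeModels Literature.Probability.Percolation
open Literature.Barriers.CriticalPhenomena
open Summit.CriticalPhenomena.PercolationContinuityZ3.Theorems.NonProliferation.Negative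

namespace WindowReduction

/-- **The birth–merge LEDGER, unconditional** (stubs `stub_signedRusso`, `stub_typeTable`,
`stub_ledger`): `E_b[N_n] - E_a[N_n] = ∫_a^b births - ∫_a^b merges` for `0 ≤ a ≤ b ≤ 1`. -/
theorem ledger :
      ∀ (d n : ℕ) (a b : ℝ), 0 ≤ a → a ≤ b → b ≤ 1 → (∑ k ∈ Finset.range (box d n).card,
      (bondPercolation (zdGraph d) (Set.projIcc (0 : ℝ) 1 zero_le_one b)).real (repEvent d k n)) -
      (∑ k ∈ Finset.range (box d n).card, (bondPercolation (zdGraph d) (Set.projIcc (0 : ℝ) 1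
      zero_le_one a)).real (repEvent d k n)) = (∫ t in a..b, ∑ e ∈ edgesIn (zdGraph d) (box d (2 *
      n)), (bondPercolation (zdGraph d) (Set.projIcc (0 : ℝ) 1 zero_le_one t)).real {ω : BondConfig
      (Site d) | ∃ x y : Site d, e = s(x, y) ∧ (∃ v ∈ box d n, ω \ {e} ∈ openConnIn (↑(box d (2 *
      n)) : Set (Site d)) x v) ∧ (∀ w ∈ innerBoundary (zdGraph d) (box d (2 * n)), ω \ {e} ∉
      openConnIn (↑(box d (2 * n)) : Set (Site d)) x w) ∧ (∃ w ∈ innerBoundary (zdGraph d) (box d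
      (2 * n)), ω \ {e} ∈ openConnIn (↑(box d (2 * n)) : Set (Site d)) y w) ∧ (∀ v ∈ box d n, ω \
      {e} ∉ openConnIn (↑(box d (2 * n)) : Set (Site d)) y v)}) - ∫ t in a..b, ∑ e ∈ edgesIn
      (zdGraph d) (box d (2 * n)), (bondPercolation (zdGraph d) (Set.projIcc (0 : ℝ) 1 zero_le_one
      t)).real {ω : BondConfig (Site d) | ∃ x y : Site d, e = s(x, y) ∧ ω \ {e} ∉ openConnIn (↑(box
      d (2 * n)) : Set (Site d)) x y ∧ (∃ v ∈ box d n, ω \ {e} ∈ openConnIn (↑(box d (2 * n)) : Set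
      (Site d)) x v) ∧ (∃ w ∈ innerBoundary (zdGraph d) (box d (2 * n)), ω \ {e} ∈ openConnIn
      (↑(box d (2 * n)) : Set (Site d)) x w) ∧ (∃ v ∈ box d n, ω \ {e} ∈ openConnIn (↑(box d (2 *
      n)) : Set (Site d)) y v) ∧ (∃ w ∈ innerBoundary (zdGraph d) (box d (2 * n)), ω \ {e} ∈
      openConnIn (↑(box d (2 * n)) : Set (Site d)) y w)} :=
  stub_ledger stub_signedRusso stub_typeTable

/-- **The LOG-LEDGER, unconditional** (all six provable stubs): for `n ≥ 1`, `b ∈ [0,1]` with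
`u_n(b) < 1`, `E_b[N_n] + ∫_0^b merges ≤ -log(1 - u_n(b))`. -/
theorem logLedger :
      ∀ (d n : ℕ) (b : ℝ), 1 ≤ n → 0 ≤ b → b ≤ 1 → (bondPercolation (zdGraph d) (Set.projIcc (0 :
      ℝ) 1 zero_le_one b)).real (annulusCrossing d n) < 1 → (∑ k ∈ Finset.range (box d n).card,
      (bondPercolation (zdGraph d) (Set.projIcc (0 : ℝ) 1 zero_le_one b)).real (repEvent d k n)) +
      (∫ t in (0 : ℝ)..b, ∑ e ∈ edgesIn (zdGraph d) (box d (2 * n)), (bondPercolation (zdGraph d)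
      (Set.projIcc (0 : ℝ) 1 zero_le_one t)).real {ω : BondConfig (Site d) | ∃ x y : Site d, e =
      s(x, y) ∧ ω \ {e} ∉ openConnIn (↑(box d (2 * n)) : Set (Site d)) x y ∧ (∃ v ∈ box d n, ω \
      {e} ∈ openConnIn (↑(box d (2 * n)) : Set (Site d)) x v) ∧ (∃ w ∈ innerBoundary (zdGraph d)
      (box d (2 * n)), ω \ {e} ∈ openConnIn (↑(box d (2 * n)) : Set (Site d)) x w) ∧ (∃ v ∈ box d
      n, ω \ {e} ∈ openConnIn (↑(box d (2 * n)) : Set (Site d)) y v) ∧ (∃ w ∈ innerBoundary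
      (zdGraph d) (box d (2 * n)), ω \ {e} ∈ openConnIn (↑(box d (2 * n)) : Set (Site d)) y w)}) ≤
      - Real.log (1 - (bondPercolation (zdGraph d) (Set.projIcc (0 : ℝ) 1 zero_le_one b)).real
      (annulusCrossing d n)) :=
  stub_logLedger ledger stub_screening stub_anchor

/-- The merge rate is nonnegative, hence so is its integral over `[0, b]`, `b ≥ 0`. -/
theorem integral_mergeRate_nonneg (d n : ℕ) {a b : ℝ} (hab : a ≤ b) :
    0 ≤ ∫ t in a..b,         ∑ e ∈ edgesIn (zdGraph d) (box d (2 * n)), (bondPercolation (zdGraph d) (Set.projIcc (0 :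
        ℝ) 1 zero_le_one t)).real {ω : BondConfig (Site d) | ∃ x y : Site d, e = s(x, y) ∧ ω \ {e}
        ∉ openConnIn (↑(box d (2 * n)) : Set (Site d)) x y ∧ (∃ v ∈ box d n, ω \ {e} ∈ openConnIn
        (↑(box d (2 * n)) : Set (Site d)) x v) ∧ (∃ w ∈ innerBoundary (zdGraph d) (box d (2 * n)),
        ω \ {e} ∈ openConnIn (↑(box d (2 * n)) : Set (Site d)) x w) ∧ (∃ v ∈ box d n, ω \ {e} ∈
        openConnIn (↑(box d (2 * n)) : Set (Site d)) y v) ∧ (∃ w ∈ innerBoundary (zdGraph d) (box d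
        (2 * n)), ω \ {e} ∈ openConnIn (↑(box d (2 * n)) : Set (Site d)) y w)} :=
  intervalIntegral.integral_nonneg hab fun _ _ => Finset.sum_nonneg fun _ _ => measureReal_nonneg

/-- **`E_p[N_n] ≤ -log(1 - u_n(p))`** at every parameter `p : unitInterval`, `n ≥ 1`, whenever the
annulus is blocked with positive probability (`u_n(p) < 1`): the log-ledger with the nonnegative
merge integral dropped. -/
theorem sum_real_repEvent_le_neg_log (d n : ℕ) (hn : 1 ≤ n) (p : unitInterval)
    (hu : (bondPercolation (zdGraph d) p).real (annulusCrossing d n) < 1) :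
    ∑ k ∈ Finset.range (box d n).card, (bondPercolation (zdGraph d) p).real (repEvent d k n) ≤
      - Real.log (1 - (bondPercolation (zdGraph d) p).real (annulusCrossing d n)) := by
  have hproj : Set.projIcc (0 : ℝ) 1 zero_le_one (p : ℝ) = p := Set.projIcc_val zero_le_one p
  have h := logLedger d n (p : ℝ) hn p.2.1 p.2.2 (by rw [hproj]; exact hu)
  rw [hproj] at h
  linarith [integral_mergeRate_nonneg d n (a := 0) (b := (p : ℝ)) p.2.1]

/-- **Exponential blocking bound**: `P_p(B(n) ↮ ∂ⁱⁿB(2n) in B(2n)) ≤ exp(-E_p[N_n])` for `n ≥ 1`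
(sharpens the BK cap `E N ≤ (1-u)/u` of `SpanningBKCap` exponentially). -/
theorem real_compl_annulusCrossing_le_exp (d n : ℕ) (hn : 1 ≤ n) (p : unitInterval) :
    (bondPercolation (zdGraph d) p).real (annulusCrossing d n)ᶜ ≤
      Real.exp (- ∑ k ∈ Finset.range (box d n).card, (bondPercolation (zdGraph d) p).real (repEvent d k n)) := by
  have hmeas : MeasurableSet (annulusCrossing d n) :=
    (repEvent_zero_eq_annulusCrossing d n) ▸ measurableSet_repEvent d 0 n
  rw [probReal_compl_eq_one_sub hmeas]
  by_cases hu : (bondPercolation (zdGraph d) p).real (annulusCrossing d n) < 1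
  · have h := sum_real_repEvent_le_neg_log d n hn p hu
    have hpos : 0 < 1 - (bondPercolation (zdGraph d) p).real (annulusCrossing d n) := by linarith
    calc 1 - (bondPercolation (zdGraph d) p).real (annulusCrossing d n)
        = Real.exp (Real.log (1 - (bondPercolation (zdGraph d) p).real (annulusCrossing d n))) :=
          (Real.exp_log hpos).symm
      _ ≤ _ := Real.exp_le_exp.2 (by linarith)
  · have h1 : (bondPercolation (zdGraph d) p).real (annulusCrossing d n) = 1 :=
      le_antisymm measureReal_le_one (not_lt.1 hu)
    rw [h1, sub_self]
    exact (Real.exp_pos _).le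

/-- `-log(1 - u) ≤ 1` for `u ≤ 1/2`. -/
theorem neg_log_one_sub_le_one {u : ℝ} (hu : u ≤ 1 / 2) : - Real.log (1 - u) ≤ 1 := by
  have h1 : (0 : ℝ) < 1 - u := by linarith
  have h2 : (1 - u)⁻¹ ≤ 2 := by
    rw [inv_le_comm₀ h1 (by norm_num : (0 : ℝ) < 2)]
    linarith
  rw [← Real.log_inv]
  calc Real.log (1 - u)⁻¹ ≤ Real.log 2 := Real.log_le_log (inv_pos.2 h1) h2
    _ ≤ 2 - 1 := Real.log_le_sub_one_of_pos (by norm_num)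
    _ = 1 := by norm_num

/-- **Markov for the layered count**: `(M+1) · P(N_n ≥ M+1) ≤ E[N_n]` when `M + 1 ≤ #B(n)`
(`repEvent` is antitone in the level). -/
theorem markov_repEvent {d M n : ℕ} (μ : Measure (BondConfig (Site d))) [IsFiniteMeasure μ]
    (hM : M + 1 ≤ (box d n).card) :
    ((M + 1 : ℕ) : ℝ) * μ.real (repEvent d M n) ≤
      ∑ k ∈ Finset.range (box d n).card, μ.real (repEvent d k n) := by
  calc ((M + 1 : ℕ) : ℝ) * μ.real (repEvent d M n)
      = ∑ _k ∈ Finset.range (M + 1), μ.real (repEvent d M n) := by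
        rw [Finset.sum_const, Finset.card_range, nsmul_eq_mul]
    _ ≤ ∑ k ∈ Finset.range (M + 1), μ.real (repEvent d k n) := by
        refine Finset.sum_le_sum fun k hk => ?_
        have hkM : k ≤ M := Nat.lt_succ_iff.1 (Finset.mem_range.1 hk)
        exact measureReal_mono (repEvent_antitone d n hkM) (measure_ne_top _ _)
    _ ≤ ∑ k ∈ Finset.range (box d n).card, μ.real (repEvent d k n) :=
        Finset.sum_le_sum_of_subset_of_nonneg (Finset.range_subset_range.2 hM)
          fun _ _ _ => measureReal_nonneg

/-- `#B(n) ≥ n + 1` in `ℤ^d`, `d ≥ 1`. -/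
theorem succ_le_card_box {d : ℕ} (hd : 1 ≤ d) (n : ℕ) : n + 1 ≤ (box d n).card := by
  rw [card_box]
  calc n + 1 ≤ 2 * n + 1 := by omega
    _ ≤ (2 * n + 1) ^ d := Nat.le_self_pow (by omega) _

/-- **Window bound on the mean**: for `n ≥ 1`, `0 ≤ s ≤ p ≤ 1` with `u_n(s) ≤ 1/2` and
`∫_s^p births ≤ C`: `E_p[N_n] ≤ C + 1` (ledger on `[s,p]`, log-ledger at `s`, `-log(1/2) ≤ 1`). -/
theorem sum_real_repEvent_le_of_window {d n : ℕ} (hn : 1 ≤ n) {s p C : ℝ} (hs0 : 0 ≤ s) (hsp : s ≤ p)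
    (hp1 : p ≤ 1) (hus : (bondPercolation (zdGraph d) (Set.projIcc (0 : ℝ) 1 zero_le_one s)).real (annulusCrossing d
      n) ≤ 1 / 2)
    (hwin : ∫ t in s..p,         ∑ e ∈ edgesIn (zdGraph d) (box d (2 * n)), (bondPercolation (zdGraph d) (Set.projIcc (0 :
        ℝ) 1 zero_le_one t)).real {ω : BondConfig (Site d) | ∃ x y : Site d, e = s(x, y) ∧ (∃ v ∈
        box d n, ω \ {e} ∈ openConnIn (↑(box d (2 * n)) : Set (Site d)) x v) ∧ (∀ w ∈ innerBoundary
        (zdGraph d) (box d (2 * n)), ω \ {e} ∉ openConnIn (↑(box d (2 * n)) : Set (Site d)) x w) ∧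
        (∃ w ∈ innerBoundary (zdGraph d) (box d (2 * n)), ω \ {e} ∈ openConnIn (↑(box d (2 * n)) :
        Set (Site d)) y w) ∧ (∀ v ∈ box d n, ω \ {e} ∉ openConnIn (↑(box d (2 * n)) : Set (Site d))
        y v)} ≤ C) :
    ∑ k ∈ Finset.range (box d n).card, (bondPercolation (zdGraph d) (Set.projIcc (0 : ℝ) 1
      zero_le_one p)).real (repEvent d k n) ≤ C + 1 := by
  have hL := ledger d n s p hs0 hsp hp1
  have hlt : (bondPercolation (zdGraph d) (Set.projIcc (0 : ℝ) 1 zero_le_one s)).real (annulusCrossing d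
        n) < 1 := by
    linarith
  have hS := logLedger d n s hn hs0 (hsp.trans hp1) hlt
  have hm1 := integral_mergeRate_nonneg d n hsp
  have hm0 := integral_mergeRate_nonneg d n hs0
  have hlog1 := neg_log_one_sub_le_one hus
  linarith

/-- **The window composition in dimension `d ≥ 1`**: a window birth budget gives `M` and `c = 1/2`
with `P_{p_c}(N_n ≤ M) ≥ 1/2` for infinitely many `n` (`M + 1 = 2⌈max C 0⌉₊ + 4`). -/
theorem frequently_of_window {d : ℕ} (hd : 1 ≤ d)
    (hW : ∃ C : ℝ, ∃ᶠ n : ℕ in atTop, ∃ s : ℝ, 0 ≤ s ∧ s ≤ (criticalProbI d : ℝ) ∧ (bondPercolation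
      (zdGraph d) (Set.projIcc (0 : ℝ) 1 zero_le_one s)).real (annulusCrossing d n) ≤ 1 / 2 ∧ ∫ t
      in s..(criticalProbI d : ℝ), ∑ e ∈ edgesIn (zdGraph d) (box d (2 * n)), (bondPercolation
      (zdGraph d) (Set.projIcc (0 : ℝ) 1 zero_le_one t)).real {ω : BondConfig (Site d) | ∃ x y :
      Site d, e = s(x, y) ∧ (∃ v ∈ box d n, ω \ {e} ∈ openConnIn (↑(box d (2 * n)) : Set (Site d))
      x v) ∧ (∀ w ∈ innerBoundary (zdGraph d) (box d (2 * n)), ω \ {e} ∉ openConnIn (↑(box d (2 *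
      n)) : Set (Site d)) x w) ∧ (∃ w ∈ innerBoundary (zdGraph d) (box d (2 * n)), ω \ {e} ∈
      openConnIn (↑(box d (2 * n)) : Set (Site d)) y w) ∧ (∀ v ∈ box d n, ω \ {e} ∉ openConnIn
      (↑(box d (2 * n)) : Set (Site d)) y v)} ≤ C) :
    ∃ (M : ℕ) (c : ℝ), 0 < c ∧ ∃ᶠ n : ℕ in atTop,
      c ≤ (bondPercolation (zdGraph d) (criticalProbI d)).real (repEvent d M n)ᶜ := by
  obtain ⟨C, hC⟩ := hW
  have hpc1 : (criticalProbI d : ℝ) ≤ 1 := (criticalProbI d).2.2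
  set C' : ℝ := max C 0 with hC'def
  have hCC' : C ≤ C' := le_max_left _ _
  set M : ℕ := 2 * ⌈C'⌉₊ + 3 with hMdef
  have hM2 : 2 * (C' + 1) ≤ ((M + 1 : ℕ) : ℝ) := by
    have hceil : C' ≤ (⌈C'⌉₊ : ℝ) := Nat.le_ceil C'
    have hcast : ((M + 1 : ℕ) : ℝ) = 2 * (⌈C'⌉₊ : ℝ) + 4 := by
      rw [hMdef]; push_cast; ring
    rw [hcast]
    linarith
  refine ⟨M, 1 / 2, by norm_num, ?_⟩
  refine (hC.and_eventually (eventually_ge_atTop M)).mono ?_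
  rintro n ⟨⟨s, hs0, hspc, hus, hwin⟩, hMn⟩
  have hn1 : 1 ≤ n := le_trans (by omega) hMn
  have hmean := sum_real_repEvent_le_of_window hn1 hs0 hspc hpc1 hus hwin
  have hcard : M + 1 ≤ (box d n).card := le_trans (by omega) (succ_le_card_box hd n)
  have hmk := markov_repEvent
    (bondPercolation (zdGraph d) (Set.projIcc (0 : ℝ) 1 zero_le_one (criticalProbI d : ℝ)))
    (M := M) (n := n) hcard
  have hpos : (0 : ℝ) < ((M + 1 : ℕ) : ℝ) := by exact_mod_cast Nat.succ_pos M
  have hprod : ((M + 1 : ℕ) : ℝ) *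
      (bondPercolation (zdGraph d) (Set.projIcc (0 : ℝ) 1 zero_le_one (criticalProbI d : ℝ))).real
        (repEvent d M n) ≤ ((M + 1 : ℕ) : ℝ) * (1 / 2) := by
    have h1 : ((M + 1 : ℕ) : ℝ) *
        (bondPercolation (zdGraph d) (Set.projIcc (0 : ℝ) 1 zero_le_one (criticalProbI d : ℝ))).real
          (repEvent d M n) ≤ C' + 1 := hmk.trans (hmean.trans (by linarith))
    linarith
  have hP := le_of_mul_le_mul_left hprod hpos
  have hproj : Set.projIcc (0 : ℝ) 1 zero_le_one (criticalProbI d : ℝ) = criticalProbI d :=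
    Set.projIcc_val zero_le_one (criticalProbI d)
  rw [hproj] at hP
  rw [probReal_compl_eq_one_sub (measurableSet_repEvent d M n)]
  linarith

end WindowReduction

/-- **The crux from the window birth budget** (registered extra stub of stmt-CriticalPhenomena-4444;
hypothesis = the line's open stub `stub_windowBirths` verbatim, conclusion = the crux BY NAME): if for
some `C` and infinitely many `n` there is `s ≤ p_c(ℤ³)` at which the annulus `B(2n) ∖ B(n)` is crossed
with probability `≤ 1/2` and the expected number of births in `[s, p_c]` is `≤ C`, then
`NonProliferation` holds (with `c = 1/2`, `M = 2⌈max C 0⌉₊ + 3`). -/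
theorem nonProliferation_of_windowBirths :
    (∃ C : ℝ, ∃ᶠ n : ℕ in atTop, ∃ s : ℝ, 0 ≤ s ∧ s ≤ (criticalProbI 3 : ℝ) ∧ (bondPercolation
      (zdGraph 3) (Set.projIcc (0 : ℝ) 1 zero_le_one s)).real (annulusCrossing 3 n) ≤ 1 / 2 ∧ ∫ t
      in s..(criticalProbI 3 : ℝ), ∑ e ∈ edgesIn (zdGraph 3) (box 3 (2 * n)), (bondPercolation
      (zdGraph 3) (Set.projIcc (0 : ℝ) 1 zero_le_one t)).real {ω : BondConfig (Site 3) | ∃ x y :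
      Site 3, e = s(x, y) ∧ (∃ v ∈ box 3 n, ω \ {e} ∈ openConnIn (↑(box 3 (2 * n)) : Set (Site 3))
      x v) ∧ (∀ w ∈ innerBoundary (zdGraph 3) (box 3 (2 * n)), ω \ {e} ∉ openConnIn (↑(box 3 (2 *
      n)) : Set (Site 3)) x w) ∧ (∃ w ∈ innerBoundary (zdGraph 3) (box 3 (2 * n)), ω \ {e} ∈
      openConnIn (↑(box 3 (2 * n)) : Set (Site 3)) y w) ∧ (∀ v ∈ box 3 n, ω \ {e} ∉ openConnIn
      (↑(box 3 (2 * n)) : Set (Site 3)) y v)} ≤ C) →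
    Summit.CriticalPhenomena.PercolationContinuityZ3.Theses.PercNonProliferation.NonProliferation := by
  intro hW
  rw [nonProliferation_iff]
  exact WindowReduction.frequently_of_window (by norm_num) hW

/-- **Calibration against `SpanningClustersAboveSix`**: in every dimension `d ≥ 7` satisfying
Aizenman's two-point condition (t-c) with `η = 0`, the window birth budget FAILS — the births inside
the critical window are unbounded along every subsequence (else the `d`-dimensional crux would hold,
contradicting `Negative.nonProliferation_false_of_twoPointBoundedRatio`, Aizenman 1997 Thm 4 (3)). -/
theorem not_windowBirths_of_twoPointBoundedRatio {d : ℕ} (hd : 6 < d) (hτ : TwoPointBoundedRatio d) :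
    ¬ (∃ C : ℝ, ∃ᶠ n : ℕ in atTop, ∃ s : ℝ, 0 ≤ s ∧ s ≤ (criticalProbI d : ℝ) ∧ (bondPercolation
        (zdGraph d) (Set.projIcc (0 : ℝ) 1 zero_le_one s)).real (annulusCrossing d n) ≤ 1 / 2 ∧ ∫ t
        in s..(criticalProbI d : ℝ), ∑ e ∈ edgesIn (zdGraph d) (box d (2 * n)), (bondPercolation
        (zdGraph d) (Set.projIcc (0 : ℝ) 1 zero_le_one t)).real {ω : BondConfig (Site d) | ∃ x y :
        Site d, e = s(x, y) ∧ (∃ v ∈ box d n, ω \ {e} ∈ openConnIn (↑(box d (2 * n)) : Set (Site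
        d)) x v) ∧ (∀ w ∈ innerBoundary (zdGraph d) (box d (2 * n)), ω \ {e} ∉ openConnIn (↑(box d
        (2 * n)) : Set (Site d)) x w) ∧ (∃ w ∈ innerBoundary (zdGraph d) (box d (2 * n)), ω \ {e} ∈
        openConnIn (↑(box d (2 * n)) : Set (Site d)) y w) ∧ (∀ v ∈ box d n, ω \ {e} ∉ openConnIn
        (↑(box d (2 * n)) : Set (Site d)) y v)} ≤ C) := by
  haveI : NeZero d := ⟨by omega⟩
  intro hW
  exact nonProliferation_false_of_twoPointBoundedRatio hd hτ
    (WindowReduction.frequently_of_window (by omega) hW)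

end Summit.CriticalPhenomena.PercolationContinuityZ3.Theorems.NonProliferation

end
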